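import Literature.Barriers.CriticalPhenomena.RigorousRGSmallParameterHHWGibbs
import Literature.Barriers.CriticalPhenomena.RigorousRGSmallParameterHHWNewman
import Literature.Probability.LatticeModels.GKSInequalities
import HarnessLib

/-!
# The critical mass window of Hara–Hattori–Watanabe §2.3: `0 < s̲_N ≤ s̄_N < ∞`

Companion of `…HHWReduction` / `…HHWGibbs` on `HaraHattoriWatanabe2001_thm11`.
The named half `HaraHattoriWatanabe2001_thm21` (Theorem 2.1) is stated on the window
`[s̲_{N₁}, s̄_{N₁}]`, `s̲_N = inf{s > 0 | μ_{2,N} ≥ 1}` ((2.11)),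
`s̄_N = inf{s > 0 | μ_{2,N} ≥ min{1 + (3/√2)μ_{4,N}, 2 + √2}}` ((2.12)), transcribed with real
infima (`HierarchicalRG.sLow`, `HierarchicalRG.sUp`). The paper's "simple observations" (1)–(2)
of §2.3 and its "Obviously, we have `0 < s̲_N ≤ s̄_N < ∞`" (p. 5) — which make the window honest
and `Thm21Hypothesis` non-vacuous (review note 3 on p18714) — are PROVED here:

* `continuous_integral_traj`, `continuous_mu2_traj`, `continuous_mu4_traj` — observation (1):
  `s ↦ μ_{2,N}(s)`, `μ_{4,N}(s)` are continuous (finite Gibbs averages, via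
  `traj_eq_isingMagnetizationLaw` and the homogeneity `J⁽ᴺ⁾(s) = s²J⁽ᴺ⁾(1)`).
* `mu2_traj_eq_sum_gksExpect`, `mu2_traj_mono` — observation (2): `μ_{2,N}(s) =
  ½(s(√c/2)^N)² Σᵢⱼ ⟨σᵢσⱼ⟩` is non-decreasing in `s ≥ 0`, by the tree's PROVED Griffiths
  inequalities (`gksExpect_mono_of_abs_le`, `gksExpect_spinProduct_nonneg` of
  `Literature/Probability/LatticeModels/GKSInequalities.lean`) through the bridge `spinEquiv`,
  `pairSupp`, `sum_div_eq_gksExpect` between Boolean configurations and `SpinConfig`;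
  `mu2_traj_ge`, `mu2_traj_le` — `½(s(√c/2)^N)²2^N ≤ μ_{2,N} ≤ ½(s(√c/2)^N)²4^N`, so
  `μ_{2,N} → 0` (`s → 0`) and `→ ∞` (`s → ∞`).
* `mu4_traj_nonneg` — Newman's positivity `μ_{4,N} ≥ 0` ((2.8), `n = 2`) for `s ≥ 0`, now a
  THEOREM: `μ_{4,N} = ½ Σ_j α_j⁻⁴` (`mu2_mu4_eq_of_newmanRepr`) under the representation (A.1),
  which the tree proves (`HaraHattoriWatanabe2001_eqA1_holds`, `…HHWNewman.lean`).
* `sLow_pos_and_le_sUp` — **`0 < s̲_N ≤ s̄_N`, both defining sets non-empty**.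

## References

* T. Hara, T. Hattori, H. Watanabe, Comm. Math. Phys. 220 (2001) 13–40, §2.3 (p. 5).
* S. Friedli, Y. Velenik, *Statistical Mechanics of Lattice Systems*, CUP 2017, §3.8.1
  (GKS inequalities, as formalised in the tree).
-/

noncomputable section


namespace Literature.Barriers.CriticalPhenomena

open _root_.MeasureTheory _root_.ProbabilityTheory _root_.Filter _root_.Set
open Literature.Probability.LatticeModels
open scoped _root_.Topology BigOperators

namespace HierarchicalRG

/-! ### Homogeneity of the couplings in `s` -/

/-- `w_N(s) = s · w_N(1)`. [folklore] -/
theorem hierWeight_eq_smul (s : ℝ) (N : ℕ) : hierWeight s N = fun i => s * hierWeight 1 N i := by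
  funext i; simp [hierWeight]

/-- **`J⁽ᴺ⁾(s) = s² J⁽ᴺ⁾(1)`**: the couplings are quadratic in the spin length `s`
(`φ = sσ`). [cite: HaraHattoriWatanabe2001, §1 (p. 1, `H_Λ`)] -/
theorem hierCoupling_eq_sq_mul (s : ℝ) :
    ∀ (N : ℕ) (i j : Fin (2 ^ N)), hierCoupling s N i j = s ^ 2 * hierCoupling 1 N i j
  | 0, i, j => by simp [hierCoupling]
  | N + 1, i, j => by
    simp only [hierCoupling, dblCoupling, dblWeight, hierWeight, one_mul]
    rw [show blockDiag (hierCoupling s N) = fun x y => s ^ 2 * blockDiag (hierCoupling 1 N) x y from ?_]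
    · ring
    · funext x y
      rcases x with x | x <;> rcases y with y | y <;> simp [blockDiag, hierCoupling_eq_sq_mul s N]

/-- The energy is quadratic in `s`. [folklore] -/
theorem isingPairEnergy_hierCoupling (s : ℝ) (N : ℕ) (σ : Fin (2 ^ N) → Bool) :
    isingPairEnergy (hierCoupling s N) σ = s ^ 2 * isingPairEnergy (hierCoupling 1 N) σ := by
  simp only [isingPairEnergy, hierCoupling_eq_sq_mul s N, Finset.mul_sum]
  refine Finset.sum_congr rfl fun i _ => Finset.sum_congr rfl fun j _ => by ring

/-- The block spin is linear in `s`. [folklore] -/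
theorem weightedMagnetization_hierWeight (s : ℝ) (N : ℕ) (σ : Fin (2 ^ N) → Bool) :
    weightedMagnetization (hierWeight s N) σ = s * hierK ^ N * ∑ i, spinVal σ i := by
  simp [weightedMagnetization, hierWeight, Finset.mul_sum]

/-! ### Continuity in `s` of expectations along the trajectory -/

/-- **`s ↦ ∫ g dh_N` is continuous** for continuous `g` (a finite Gibbs average whose weights
`e^{s²E(σ)}/Z(s)` and atoms `s(√c/2)^N Σσ` depend continuously on `s`) — observation (1) of §2.3
("`μ_{2,N}` is continuous in the Ising parameter `s`, because `h_N(x)dx` is a result of a finite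
number of renormalization group transformations"). [cite: HaraHattoriWatanabe2001, §2.3 (p. 5)] -/
theorem continuous_integral_traj (N : ℕ) {g : ℝ → ℝ} (hg : Continuous g) :
    Continuous fun s : ℝ => ∫ x, g x ∂(traj s N) := by
  have h : ∀ s : ℝ, ∫ x, g x ∂(traj s N) =
      ∑ σ : Fin (2 ^ N) → Bool, Real.exp (s ^ 2 * isingPairEnergy (hierCoupling 1 N) σ) /
        (∑ σ' : Fin (2 ^ N) → Bool, Real.exp (s ^ 2 * isingPairEnergy (hierCoupling 1 N) σ')) *
        g (s * hierK ^ N * ∑ i, spinVal σ i) := by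
    intro s
    rw [traj_eq_isingMagnetizationLaw, integral_isingMagnetizationLaw _ _ hg.measurable]
    simp only [isingBoltzmann, isingPairPartition, isingPairEnergy_hierCoupling s N,
      weightedMagnetization_hierWeight]
  simp_rw [h]
  refine continuous_finsetSum _ fun σ _ => ?_
  refine Continuous.mul (Continuous.div (by fun_prop) (by fun_prop) fun s => ?_) (hg.comp (by fun_prop))
  exact (Finset.sum_pos (fun σ' _ => Real.exp_pos _) Finset.univ_nonempty).ne'

/-- `s ↦ μ_{2,N}(s)` is continuous. [cite: HaraHattoriWatanabe2001, §2.3 (p. 5, (1))] -/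
theorem continuous_mu2_traj (N : ℕ) : Continuous fun s : ℝ => mu2 (traj s N) := by
  simp only [mu2_eq]
  exact (continuous_integral_traj N (continuous_pow 2)).div_const 2

/-- `s ↦ μ_{4,N}(s)` is continuous. [cite: HaraHattoriWatanabe2001, §4 (p. 14)] -/
theorem continuous_mu4_traj (N : ℕ) : Continuous fun s : ℝ => mu4 (traj s N) := by
  simp only [mu4_eq]
  exact (((continuous_integral_traj N (continuous_pow 2)).pow 2).div_const 8).sub
    ((continuous_integral_traj N (continuous_pow 4)).div_const 24)

/-! ### The Gibbs averages as `gksExpect`: Griffiths' inequalities for the hierarchical model -/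

section GKSBridge

variable {n : ℕ}

/-- Boolean spin configurations as `ℤˣ`-valued ones. [folklore] -/
def spinEquiv (n : ℕ) : (Fin n → Bool) ≃ SpinConfig (Fin n) where
  toFun σ i := if σ i then 1 else -1
  invFun ω i := decide (ω i = 1)
  left_inv σ := by
    funext i; cases h : σ i <;> simp [h]
  right_inv ω := by
    funext i
    rcases Int.units_eq_one_or (ω i) with h | h <;> simp [h]

/-- The spins agree under the identification. [folklore] -/
theorem spinAt_spinEquiv (σ : Fin n → Bool) (i : Fin n) :
    spinAt i (spinEquiv n σ) = spinVal σ i := by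
  simp only [spinAt, spinVal, spinEquiv, Equiv.coe_fn_mk]
  rcases Bool.eq_false_or_eq_true (σ i) with h | h <;> simp [h]

/-- The pair supports: `∅` on the diagonal (`σᵢ² = 1`), `{i, j}` off it. [folklore] -/
def pairSupp (p : Fin n × Fin n) : Finset (Fin n) := if p.1 = p.2 then ∅ else {p.1, p.2}

/-- `σ_{C(i,j)} = σᵢσⱼ`. [folklore] -/
theorem spinProduct_pairSupp (p : Fin n × Fin n) (σ : Fin n → Bool) :
    spinProduct (pairSupp p) (spinEquiv n σ) = spinVal σ p.1 * spinVal σ p.2 := by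
  unfold pairSupp spinProduct
  split_ifs with h
  · rw [Finset.prod_empty, h]
    unfold spinVal; cases σ p.2 <;> simp
  · rw [Finset.prod_pair h, spinAt_spinEquiv, spinAt_spinEquiv]

/-- The Gibbs weight `e^{Σ Jᵢⱼσᵢσⱼ}` is the GKS weight with couplings `Jᵢⱼ` on the pair supports.
[folklore] -/
theorem gksWeight_eq_isingBoltzmann (J : Fin n → Fin n → ℝ) (σ : Fin n → Bool) :
    gksWeight Finset.univ (fun p : Fin n × Fin n => J p.1 p.2) pairSupp (spinEquiv n σ) =
      isingBoltzmann J σ := by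
  rw [gksWeight, gksHamiltonian, isingBoltzmann, isingPairEnergy, ← Finset.univ_product_univ,
    Finset.sum_product]
  congr 1
  refine Finset.sum_congr rfl fun i _ => Finset.sum_congr rfl fun j _ => ?_
  rw [spinProduct_pairSupp]; ring

/-- **Gibbs averages of the finite Ising system are `gksExpect`s.** [folklore] -/
theorem sum_div_eq_gksExpect (J : Fin n → Fin n → ℝ) (F : (Fin n → Bool) → ℝ) :
    ∑ σ : Fin n → Bool, isingBoltzmann J σ / isingPairPartition J * F σ =
      gksExpect Finset.univ (fun p : Fin n × Fin n => J p.1 p.2) pairSupp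
        (fun ω => F ((spinEquiv n).symm ω)) := by
  classical
  rw [gksExpect, gksSum, gksSum]
  rw [← (spinEquiv n).sum_comp, ← (spinEquiv n).sum_comp (fun ω => (1 : ℝ) * gksWeight _ _ _ ω)]
  simp only [Equiv.symm_apply_apply, gksWeight_eq_isingBoltzmann, one_mul, Finset.sum_div]
  refine Finset.sum_congr rfl fun σ _ => ?_
  rw [isingPairPartition]
  ring

/-- Two-point Gibbs averages are `gksExpect`s of pair products. [folklore] -/
theorem sum_div_spinPair_eq_gksExpect (J : Fin n → Fin n → ℝ) (p : Fin n × Fin n) :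
    ∑ σ : Fin n → Bool, isingBoltzmann J σ / isingPairPartition J * (spinVal σ p.1 * spinVal σ p.2) =
      gksExpect Finset.univ (fun p : Fin n × Fin n => J p.1 p.2) pairSupp (spinProduct (pairSupp p)) := by
  rw [sum_div_eq_gksExpect]
  congr 1
  funext ω
  rw [← spinProduct_pairSupp, Equiv.apply_symm_apply]

end GKSBridge

/-- **`μ_{2,N}` as a sum of two-point functions**:
`μ_{2,N}(s) = ½ (s(√c/2)^N)² Σ_{i,j} ⟨σᵢσⱼ⟩_{J⁽ᴺ⁾(s)}` (GKS form). [folklore] -/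
theorem mu2_traj_eq_sum_gksExpect (s : ℝ) (N : ℕ) :
    mu2 (traj s N) = (s * hierK ^ N) ^ 2 / 2 *
      ∑ p : Fin (2 ^ N) × Fin (2 ^ N), gksExpect Finset.univ
        (fun p : Fin (2 ^ N) × Fin (2 ^ N) => hierCoupling s N p.1 p.2) pairSupp
        (spinProduct (pairSupp p)) := by
  classical
  rw [mu2_eq, traj_eq_isingMagnetizationLaw, integral_isingMagnetizationLaw _ _ (continuous_pow 2).measurable]
  simp only [weightedMagnetization_hierWeight]
  have h : ∀ σ : Fin (2 ^ N) → Bool, isingBoltzmann (hierCoupling s N) σ / isingPairPartition (hierCoupling s N) *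
      (s * hierK ^ N * ∑ i, spinVal σ i) ^ 2 = (s * hierK ^ N) ^ 2 *
      (isingBoltzmann (hierCoupling s N) σ / isingPairPartition (hierCoupling s N) *
        ∑ p : Fin (2 ^ N) × Fin (2 ^ N), spinVal σ p.1 * spinVal σ p.2) := by
    intro σ
    rw [← Finset.univ_product_univ, Finset.sum_product, ← Finset.sum_mul_sum]
    ring
  simp_rw [h, ← Finset.mul_sum]
  have hswap : (∑ σ : Fin (2 ^ N) → Bool, isingBoltzmann (hierCoupling s N) σ /
      isingPairPartition (hierCoupling s N) * ∑ p : Fin (2 ^ N) × Fin (2 ^ N), spinVal σ p.1 * spinVal σ p.2)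
      = ∑ p : Fin (2 ^ N) × Fin (2 ^ N), ∑ σ : Fin (2 ^ N) → Bool,
        isingBoltzmann (hierCoupling s N) σ / isingPairPartition (hierCoupling s N) *
          (spinVal σ p.1 * spinVal σ p.2) := by
    simp_rw [Finset.mul_sum]
    exact Finset.sum_comm
  rw [hswap]
  simp_rw [sum_div_spinPair_eq_gksExpect]
  ring

/-- **`μ_{2,N}(s)` is non-decreasing in `s ≥ 0`** — observation (2) of §2.3 ("`μ_{2,N}` is
increasing in `s`"), by Griffiths' comparison inequality (tree: `gksExpect_mono_of_abs_le`,
GKS II) for the two-point functions and `J⁽ᴺ⁾(s) = s²J⁽ᴺ⁾(1) ≥ 0`, and GKS I for their sign.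
[cite: HaraHattoriWatanabe2001, §2.3 (p. 5, (2))] -/
theorem mu2_traj_mono (N : ℕ) : MonotoneOn (fun s : ℝ => mu2 (traj s N)) (Set.Ici 0) := by
  classical
  intro s hs s' hs' hss'
  simp only [mu2_traj_eq_sum_gksExpect]
  have hJabs : ∀ p ∈ (Finset.univ : Finset (Fin (2 ^ N) × Fin (2 ^ N))),
      |hierCoupling s N p.1 p.2| ≤ hierCoupling s' N p.1 p.2 := by
    intro p _
    rw [abs_of_nonneg (hierCoupling_nonneg s N _ _), hierCoupling_eq_sq_mul s, hierCoupling_eq_sq_mul s']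
    exact mul_le_mul_of_nonneg_right (pow_le_pow_left₀ hs hss' 2) (hierCoupling_nonneg 1 N _ _)
  have hsum_mono : ∑ p : Fin (2 ^ N) × Fin (2 ^ N), gksExpect Finset.univ
        (fun p : Fin (2 ^ N) × Fin (2 ^ N) => hierCoupling s N p.1 p.2) pairSupp (spinProduct (pairSupp p)) ≤
      ∑ p : Fin (2 ^ N) × Fin (2 ^ N), gksExpect Finset.univ
        (fun p : Fin (2 ^ N) × Fin (2 ^ N) => hierCoupling s' N p.1 p.2) pairSupp (spinProduct (pairSupp p)) :=
    Finset.sum_le_sum fun p _ => gksExpect_mono_of_abs_le _ _ hJabs _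
  have hsum_nonneg : 0 ≤ ∑ p : Fin (2 ^ N) × Fin (2 ^ N), gksExpect Finset.univ
        (fun p : Fin (2 ^ N) × Fin (2 ^ N) => hierCoupling s N p.1 p.2) pairSupp (spinProduct (pairSupp p)) :=
    Finset.sum_nonneg fun p _ => gksExpect_spinProduct_nonneg _ _ _
      (fun q _ => hierCoupling_nonneg s N _ _) _
  have hpre : (s * hierK ^ N) ^ 2 / 2 ≤ (s' * hierK ^ N) ^ 2 / 2 := by
    have hk : 0 ≤ hierK ^ N := (pow_pos hierK_pos N).le
    have : s * hierK ^ N ≤ s' * hierK ^ N := mul_le_mul_of_nonneg_right hss' hk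
    have h0 : 0 ≤ s * hierK ^ N := mul_nonneg hs hk
    nlinarith
  calc (s * hierK ^ N) ^ 2 / 2 * _ ≤ (s' * hierK ^ N) ^ 2 / 2 * _ :=
        mul_le_mul_of_nonneg_right hpre hsum_nonneg
    _ ≤ (s' * hierK ^ N) ^ 2 / 2 * _ := mul_le_mul_of_nonneg_left hsum_mono (by positivity)

/-- **Lower bound `μ_{2,N}(s) ≥ ½ (s(√c/2)^N)² 2^N`** (diagonal terms `⟨σᵢ²⟩ = 1`, off-diagonal
`⟨σᵢσⱼ⟩ ≥ 0` by GKS I) — so `μ_{2,N} → ∞` as `s → ∞` (observation (2) of §2.3).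
[cite: HaraHattoriWatanabe2001, §2.3 (p. 5, (2))] -/
theorem mu2_traj_ge (s : ℝ) (N : ℕ) : (s * hierK ^ N) ^ 2 / 2 * 2 ^ N ≤ mu2 (traj s N) := by
  classical
  rw [mu2_traj_eq_sum_gksExpect]
  refine mul_le_mul_of_nonneg_left ?_ (by positivity)
  have hdiag : ∀ i : Fin (2 ^ N), gksExpect Finset.univ
      (fun p : Fin (2 ^ N) × Fin (2 ^ N) => hierCoupling s N p.1 p.2) pairSupp (spinProduct (pairSupp (i, i))) = 1 := by
    intro i
    simp only [pairSupp, if_true]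
    rw [show spinProduct (∅ : Finset (Fin (2 ^ N))) = fun _ => (1 : ℝ) from funext fun ω => spinProduct_empty ω,
      gksExpect, div_self (gksSum_one_pos _ _ _).ne']
  calc (2 : ℝ) ^ N = ∑ i : Fin (2 ^ N), gksExpect Finset.univ
        (fun p : Fin (2 ^ N) × Fin (2 ^ N) => hierCoupling s N p.1 p.2) pairSupp (spinProduct (pairSupp (i, i))) := by
        simp [hdiag]
    _ = ∑ p ∈ (Finset.univ : Finset (Fin (2 ^ N) × Fin (2 ^ N))).filter (fun p => p.1 = p.2),
          gksExpect Finset.univ (fun p : Fin (2 ^ N) × Fin (2 ^ N) => hierCoupling s N p.1 p.2) pairSupp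
            (spinProduct (pairSupp p)) := by
        rw [Finset.sum_filter]
        rw [← Finset.univ_product_univ, Finset.sum_product]
        refine Finset.sum_congr rfl fun i _ => ?_
        rw [Finset.sum_ite_eq Finset.univ i]
        simp
    _ ≤ _ := Finset.sum_le_univ_sum_of_nonneg fun p => gksExpect_spinProduct_nonneg _ _ _
          (fun q _ => hierCoupling_nonneg s N _ _) _

/-- **Upper bound `μ_{2,N}(s) ≤ ½ (s(√c/2)^N)² 4^N`** (`|⟨σᵢσⱼ⟩| ≤ 1`) — so `μ_{2,N} → 0` as
`s → 0` (observation (2) of §2.3). [cite: HaraHattoriWatanabe2001, §2.3 (p. 5, (2))] -/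
theorem mu2_traj_le (s : ℝ) (N : ℕ) : mu2 (traj s N) ≤ (s * hierK ^ N) ^ 2 / 2 * 4 ^ N := by
  rw [mu2_eq, traj_eq_isingMagnetizationLaw, integral_isingMagnetizationLaw _ _ (continuous_pow 2).measurable]
  simp only [weightedMagnetization_hierWeight]
  have hb : ∀ σ : Fin (2 ^ N) → Bool, (s * hierK ^ N * ∑ i, spinVal σ i) ^ 2 ≤ (s * hierK ^ N) ^ 2 * 4 ^ N := by
    intro σ
    rw [mul_pow]
    refine mul_le_mul_of_nonneg_left ?_ (sq_nonneg _)
    have : |∑ i : Fin (2 ^ N), spinVal σ i| ≤ 2 ^ N := by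
      refine (Finset.abs_sum_le_sum_abs _ _).trans ?_
      have : ∀ i, |spinVal σ i| = 1 := fun i => by unfold spinVal; split_ifs <;> simp
      simp [this]
    have h2 : (∑ i : Fin (2 ^ N), spinVal σ i) ^ 2 ≤ (2 ^ N) ^ 2 := by
      rw [← sq_abs]; exact pow_le_pow_left₀ (abs_nonneg _) this 2
    calc (∑ i : Fin (2 ^ N), spinVal σ i) ^ 2 ≤ (2 ^ N) ^ 2 := h2
      _ = 4 ^ N := by rw [← pow_mul, mul_comm, pow_mul]; norm_num
  have hq : ∀ σ : Fin (2 ^ N) → Bool, 0 ≤ isingBoltzmann (hierCoupling s N) σ / isingPairPartition (hierCoupling s N) :=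
    fun σ => div_nonneg (isingBoltzmann_pos _ σ).le (isingPairPartition_pos _).le
  have hsum1 : ∑ σ : Fin (2 ^ N) → Bool, isingBoltzmann (hierCoupling s N) σ / isingPairPartition (hierCoupling s N) = 1 := by
    rw [← Finset.sum_div, ← isingPairPartition, div_self (isingPairPartition_pos _).ne']
  calc (∑ σ : Fin (2 ^ N) → Bool, isingBoltzmann (hierCoupling s N) σ / isingPairPartition (hierCoupling s N) *
        (s * hierK ^ N * ∑ i, spinVal σ i) ^ 2) / 2
      ≤ (∑ σ : Fin (2 ^ N) → Bool, isingBoltzmann (hierCoupling s N) σ / isingPairPartition (hierCoupling s N) *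
        ((s * hierK ^ N) ^ 2 * 4 ^ N)) / 2 := by
        gcongr with σ
        · exact hq σ
        · exact hb σ
    _ = (s * hierK ^ N) ^ 2 / 2 * 4 ^ N := by rw [← Finset.sum_mul, hsum1]; ring

/-! ### Newman's positivity `μ_{4,N} ≥ 0` -/

/-- **`μ_{4,N} ≥ 0` along the trajectory** (`s ≥ 0`) — (2.8)/(A.3) for `n = 2`, a THEOREM: by
the tree's `HaraHattoriWatanabe2001_eqA1_holds` (Newman's product (A.1)) and
`mu2_mu4_eq_of_newmanRepr`, `μ_{4,N} = ½ Σ_j α_j⁻⁴ ≥ 0`.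
[cite: HaraHattoriWatanabe2001, §2.2 eq. (2.8)] [cite: Newman1975, Theorem 3] -/
theorem mu4_traj_nonneg {s : ℝ} (hs : 0 ≤ s) (N : ℕ) : 0 ≤ mu4 (traj s N) := by
  obtain ⟨ι, b, α, -, -, hsum, hrepr⟩ := HaraHattoriWatanabe2001_eqA1_holds s hs N
  rw [(mu2_mu4_eq_of_newmanRepr (isBddLaw_traj s N) hsum hrepr).2]
  exact div_nonneg (tsum_nonneg fun j => sq_nonneg _) (by norm_num)

/-! ### The critical mass window `0 < s̲_N ≤ s̄_N < ∞` -/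

/-- **"Obviously, we have `0 < s̲_N ≤ s̄_N < ∞`"** (§2.3, after (2.12)): the defining sets of
`s̲_N = inf{s > 0 | μ_{2,N} ≥ 1}` and `s̄_N = inf{s > 0 | μ_{2,N} ≥ min{1 + (3/√2)μ_{4,N}, 2 + √2}}`
are non-empty (large `s`, `mu2_traj_ge`) and contained in `[δ, ∞)` for some `δ > 0` (small `s`,
`mu2_traj_le`), the second inside the first (`μ_{4,N} ≥ 0`, `mu4_traj_nonneg`); hence the
infima are honest, positive and ordered. [cite: HaraHattoriWatanabe2001, §2.3 (p. 5)] -/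
theorem sLow_pos_and_le_sUp (N : ℕ) :
    0 < sLow N ∧ sLow N ≤ sUp N ∧
      {s : ℝ | 0 < s ∧ 1 ≤ mu2 (traj s N)}.Nonempty ∧
      {s : ℝ | 0 < s ∧ min (1 + 3 / Real.sqrt 2 * mu4 (traj s N)) (2 + Real.sqrt 2) ≤ mu2 (traj s N)}.Nonempty := by
  set S₁ := {s : ℝ | 0 < s ∧ 1 ≤ mu2 (traj s N)} with hS₁
  set S₂ := {s : ℝ | 0 < s ∧ min (1 + 3 / Real.sqrt 2 * mu4 (traj s N)) (2 + Real.sqrt 2) ≤ mu2 (traj s N)}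
    with hS₂
  have hk : 0 < hierK ^ N := pow_pos hierK_pos N
  -- a large `s` lies in `S₂ ⊆ S₁`
  have hsub : S₂ ⊆ S₁ := by
    rintro s ⟨hs, h⟩
    refine ⟨hs, le_trans ?_ h⟩
    refine le_min ?_ ?_
    · have := mu4_traj_nonneg hs.le N
      have : 0 ≤ 3 / Real.sqrt 2 * mu4 (traj s N) := by positivity
      linarith
    · have := Real.sqrt_nonneg 2; linarith
  have hne₂ : S₂.Nonempty := by
    -- choose `s` with `(s k^N)² 2^N / 2 ≥ 4 ≥ 2 + √2`
    set s₀ : ℝ := 4 / hierK ^ N with hs₀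
    refine ⟨s₀, div_pos (by norm_num) hk, le_trans (min_le_right _ _) ?_⟩
    have h2 : Real.sqrt 2 ≤ 2 := by
      calc Real.sqrt 2 ≤ Real.sqrt (2 ^ 2) := Real.sqrt_le_sqrt (by norm_num)
        _ = 2 := Real.sqrt_sq (by norm_num)
    refine le_trans ?_ (mu2_traj_ge s₀ N)
    have e : s₀ * hierK ^ N = 4 := by rw [hs₀]; field_simp
    rw [e]
    have : (1 : ℝ) ≤ 2 ^ N := one_le_pow₀ (by norm_num)
    nlinarith
  have hne₁ : S₁.Nonempty := hne₂.mono hsub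
  -- a small positive `δ` bounds both sets from below
  obtain ⟨δ, hδ, hδS⟩ : ∃ δ : ℝ, 0 < δ ∧ ∀ s ∈ S₁, δ ≤ s := by
    set δ : ℝ := 1 / (hierK ^ N * 2 ^ N) with hδ
    refine ⟨δ, div_pos one_pos (mul_pos hk (by positivity)), fun s hs => ?_⟩
    obtain ⟨hs0, hs1⟩ := hs
    by_contra hlt
    push Not at hlt
    have hle := mu2_traj_le s N
    have e : δ * (hierK ^ N * 2 ^ N) = 1 := by rw [hδ]; field_simp
    have h4 : (4 : ℝ) ^ N = (2 ^ N) ^ 2 := by rw [← pow_mul, mul_comm, pow_mul]; norm_num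
    have hsk : s * hierK ^ N * 2 ^ N < 1 := by
      calc s * hierK ^ N * 2 ^ N < δ * hierK ^ N * 2 ^ N := by gcongr
        _ = 1 := by rw [← e]; ring
    have hsk0 : 0 ≤ s * hierK ^ N * 2 ^ N := mul_nonneg (mul_nonneg hs0.le hk.le) (by positivity)
    have : (s * hierK ^ N) ^ 2 / 2 * 4 ^ N < 1 := by
      rw [h4]
      have : (s * hierK ^ N * 2 ^ N) ^ 2 < 1 := by nlinarith
      nlinarith
    linarith
  have hbdd₁ : BddBelow S₁ := ⟨δ, fun s hs => hδS s hs⟩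
  have hlow : δ ≤ sLow N := le_csInf hne₁ fun s hs => hδS s hs
  refine ⟨lt_of_lt_of_le hδ hlow, ?_, hne₁, hne₂⟩
  exact csInf_le_csInf hbdd₁ hne₂ hsub

end HierarchicalRG

end Literature.Barriers.CriticalPhenomena

end
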